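import Summits.HubbardSuperconductivity.HubbardSuperconductivity.Theorems.WeakCouplingBCSWcbcsSsbToTorusLROPairCommutatorBudget
import Summits.HubbardSuperconductivity.HubbardSuperconductivity.Theorems.WeakCouplingBCSWcbcsSsbToTorusLROMomentClosure
import Summits.HubbardSuperconductivity.HubbardSuperconductivity.Theorems.WeakCouplingBCSWcbcsSsbToTorusLROTwoParticleCost
import Summits.HubbardSuperconductivity.HubbardSuperconductivity.Theorems.SsbToEvenTorusLro.Negative.SzLabelAndOddSector
import Literature.MathematicalPhysics.QuantumLattice.HubbardOneParticleCost
import Literature.MathematicalPhysics.QuantumLattice.HubbardRingPerronFrobeniusProofs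
import Literature.MathematicalPhysics.QuantumLattice.SectorSpectrum
import HarnessLib

/-!
# Route `AposterioriCapRg` — crux `SsbToEvenTorusLro` (stmt-HubbardSuperconductivity-1315),
# line `floating-mu-two-sided-pair-transfer`, stub `stub_pairTransferRung` (the RUNG)

The finite-`L` engine of the sector-hopping ladder. Let `H = hubbardTorus 2 L 1 U` (any real `U`),
`P = pairField dWaveFormFactor L` (the `d`-wave pair field; `P` lowers the particle number by two and
commutes with `S^z`), `E_k = minEnergyOn H (szSector k 0)`, and let `ψ` be a normalised ground state of
`H` in the joint sector `(m + 2, S^z = 0)` with `aL² ≤ m`, `m + 4 ≤ (2 - a)L²` (`a > 0`). Write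
`S₋ = Re⟨ψ, PᴴPψ⟩ = ‖Pψ‖²`, `S₊ = Re⟨ψ, PPᴴψ⟩ = ‖Pᴴψ‖²`. Then, with a constant `C = C(U, a)`:

1. `Pψ ∈ szSector m 0`, 2. `Pᴴψ ∈ szSector (m + 4) 0` (CAR bookkeeping,
   `pairFieldAt_mulVec_mem_szSector`, `conjTranspose_pairFieldAt_mulVec_mem_szSector` at momentum `0`);
3. the two-sided Koma–Tasaki transfer inequality
   `(Re⟨Pψ, HPψ⟩ - E_m S₋) + (Re⟨Pᴴψ, HPᴴψ⟩ - E_{m+4} S₊) ≤ CL² + max(0, 2E_{m+2} - E_m - E_{m+4}) S₋`: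
   by the reversed Feynman–Bijl (own-bottom) identity `mc_dotProduct_doubleComm_of_eigen`
   (`Hψ = E_{m+2}ψ`, `H` Hermitian) the left side equals
   `Re⟨ψ,(Pᴴ[H,P] - [H,P]Pᴴ)ψ⟩ + (2E_{m+2} - E_m - E_{m+4}) S₋ + (E_{m+2} - E_{m+4})(S₊ - S₋)`, and the
   three pieces are bounded by the graded-locality double-commutator bound
   `dcq_norm_doubleCommutator_pairFieldAt_le` (`O(L²)`), by `max(0,·) S₋` (`S₋ ≥ 0`), and by the
   two-particle cost `|E_{m+2} - E_{m+4}| = O_{U,a}(1)` (`groundEnergyAt_succ_le` / `groundEnergyAt_pred_le`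
   twice each, with the bulk-window weights `2|Λ|/(2|Λ| - N), 2|Λ|/N ≤ 2/a`, and the `SU(2)` identification
   `groundEnergyAt_eq_minEnergyOn_szSector`) times the single-commutator budget
   `|S₊ - S₋| = |Re⟨ψ,(PPᴴ - PᴴP)ψ⟩| = O(L²)` (`stub_pairCommutatorBudget`);
4. lro inheritance under `P`: `S₋² - CL² S₋ ≤ Re⟨Pψ, PᴴP Pψ⟩ = ‖PPψ‖²`, since
   `‖PPψ‖² = ‖PᴴPψ‖² + Re⟨Pψ, (PᴴP - PPᴴ) Pψ⟩ ≥ S₋² - O(L²) S₋` (Cauchy–Schwarz with `‖ψ‖ = 1` and the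
   single-commutator budget again);
5. lro inheritance under `Pᴴ`: `S₊² ≤ Re⟨Pᴴψ, PᴴP Pᴴψ⟩ = ‖PPᴴψ‖²` (Cauchy–Schwarz, exact);
6. `|S₊ - S₋| ≤ CL²`.

The parity guard: `m + 2` is even, for otherwise `szSector (m + 2) 0 = ⊥` contains no ground state
(`not_isGroundStateInSector_zero_odd`). Everything is finite-dimensional linear algebra over landed tree
lemmas; no definition and no named fact is introduced.

Sources: T. Koma, H. Tasaki, J. Stat. Phys. 76 (1994) 745, eq. (2.9) and the proof of Theorem 2.2 (the
double-commutator method); L. Pitaevskii, S. Stringari, J. Low Temp. Phys. 85 (1991) 377; H. Tasaki,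
H. Watanabe (2021) (own-bottom identity); D. Ruelle, *Statistical Mechanics* (1969) §3.4 (one-particle
cost).
-/

noncomputable section

namespace Summit.HubbardSuperconductivity.HubbardSuperconductivity.Theorems

-- summit = problem name (single-conjunct summit), D-0017
set_option linter.dupNamespace false

open Literature.MathematicalPhysics.QuantumLattice Literature.Probability.LatticeModels
open Filter Set Matrix
open scoped ComplexOrder ComplexConjugate Matrix.Norms.L2Operator

/-! ## §1 The two graded-locality budgets at momentum zero -/

/-- **Single-commutator budget for the `d`-wave pair field** `P = pairField dWaveFormFactor L`:
`|Re⟨φ, (PᴴP - PPᴴ)φ⟩| ≤ B L² ⟨φ, φ⟩` with `B ≥ 0` independent of `L` — the momentum-zero case of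
`stub_pairCommutatorBudget` (`pairFieldAt_zero`). Koma–Tasaki 1994, proof of Theorem 2.2.
[cite: KomaTasaki1994, Theorem 2.2] -/
theorem ptr_pairCommutator_budget :
    ∃ B : ℝ, 0 ≤ B ∧ ∀ (L : ℕ) [NeZero L] (φ : Fock (Orb (FermionTorus 2 L))),
      |(star φ ⬝ᵥ (((pairField dWaveFormFactor L)ᴴ * pairField dWaveFormFactor L -
          pairField dWaveFormFactor L * (pairField dWaveFormFactor L)ᴴ) *ᵥ φ)).re| ≤
        B * (L : ℝ) ^ 2 * (star φ ⬝ᵥ φ).re := by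
  obtain ⟨B, hB0, hB⟩ := WcbcsSsbToTorusLRO.stub_pairCommutatorBudget
  refine ⟨B, hB0, fun L _ φ => ?_⟩
  have h := hB L 0 φ
  rwa [pairFieldAt_zero] at h

/-- **Double-commutator budget for the `d`-wave pair field and the torus Hubbard Hamiltonian**
`H = hubbardTorus 2 L 1 U` (any real `U`): `|Re⟨φ, (Pᴴ[H,P] - [H,P]Pᴴ)φ⟩| ≤ C L² ⟨φ, φ⟩` with
`C = 36 s²(s+2) K² (2 + |U|) ≥ 0` — the momentum-zero, `μ = 0` case of
`dcq_norm_doubleCommutator_pairFieldAt_le` (orientation flipped, which does not change the norm),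
turned into a quadratic-form bound by `abs_re_star_dotProduct_mulVec_le`. Koma–Tasaki 1994, proof of
Theorem 2.2. [cite: KomaTasaki1994, Theorem 2.2] -/
theorem ptr_doubleComm_budget (U : ℝ) :
    ∃ C : ℝ, 0 ≤ C ∧ ∀ (L : ℕ) [NeZero L] (φ : Fock (Orb (FermionTorus 2 L))),
      |(star φ ⬝ᵥ (((pairField dWaveFormFactor L)ᴴ *
            (hubbardTorus 2 L 1 U * pairField dWaveFormFactor L -
              pairField dWaveFormFactor L * hubbardTorus 2 L 1 U) -
          (hubbardTorus 2 L 1 U * pairField dWaveFormFactor L -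
              pairField dWaveFormFactor L * hubbardTorus 2 L 1 U) *
            (pairField dWaveFormFactor L)ᴴ) *ᵥ φ)).re| ≤
        C * (L : ℝ) ^ 2 * (star φ ⬝ᵥ φ).re := by
  set s : ℕ := (insert (0 : Site 2) unitSteps).card with hs_def
  set K : ℝ := 2 * ∑ e ∈ insert (0 : Site 2) unitSteps, |dWaveFormFactor e / Real.sqrt 2|
    with hK_def
  refine ⟨36 * (s : ℝ) ^ 2 * (s + 2) * K ^ 2 * (2 * |(1 : ℝ)| + |U| + 2 * |(0 : ℝ)|),
    by positivity, fun L _ φ => ?_⟩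
  have h0 := dcq_norm_doubleCommutator_pairFieldAt_le dWaveFormFactor L 1 U 0 0
  rw [pairFieldAt_zero, hubbardTorusWith_zero] at h0
  set A := pairField dWaveFormFactor L with hA_def
  set H := hubbardTorus 2 L 1 U with hH_def
  -- the registered orientation `Aᴴ[H,A] - [H,A]Aᴴ` is minus `Aᴴ[A,H] - [A,H]Aᴴ`
  have hflip : Aᴴ * (H * A - A * H) - (H * A - A * H) * Aᴴ =
      -(Aᴴ * (A * H - H * A) - (A * H - H * A) * Aᴴ) := by
    rw [← neg_sub (A * H) (H * A), mul_neg, neg_mul, neg_sub_neg, neg_sub]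
  have hnorm : ‖Aᴴ * (H * A - A * H) - (H * A - A * H) * Aᴴ‖ ≤
      36 * (s : ℝ) ^ 2 * (s + 2) * K ^ 2 * (2 * |(1 : ℝ)| + |U| + 2 * |(0 : ℝ)|) * (L : ℝ) ^ 2 := by
    rw [hflip, norm_neg]
    exact h0
  have hray := abs_re_star_dotProduct_mulVec_le (Aᴴ * (H * A - A * H) - (H * A - A * H) * Aᴴ) φ
  have hφ : 0 ≤ (star φ ⬝ᵥ φ).re := (Complex.nonneg_iff.1 (dotProduct_star_self_nonneg φ)).1
  exact hray.trans (mul_le_mul_of_nonneg_right hnorm hφ)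

/-! ## §2 The two-particle cost in the bulk density window -/

section TwoParticleCost

variable {Λ : Type*} [LinearOrder Λ] [Fintype Λ] (G : SimpleGraph Λ) [DecidableRel G.Adj]

/-- Weight bookkeeping: `K · 2x / b ≤ (2/a) K` if `0 ≤ K`, `0 < a`, `0 < x` and `a x ≤ b`. [folklore] -/
theorem ptr_weight_le {K a x b : ℝ} (hK : 0 ≤ K) (ha : 0 < a) (hx : 0 < x) (hb : a * x ≤ b) :
    K * (2 * x) / b ≤ 2 / a * K := by
  have hb0 : 0 < b := lt_of_lt_of_le (mul_pos ha hx) hb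
  rw [div_le_iff₀ hb0]
  have e : K * (2 * x) = 2 / a * K * (a * x) := by
    field_simp
  rw [e]
  exact mul_le_mul_of_nonneg_left hb (by positivity)

/-- **The two-particle cost on a graph of maximal degree `≤ Δ`, bulk-window form.** If
`a|Λ| ≤ M + 1` and `M + 2 ≤ (2 - a)|Λ|` (`a > 0`) then `|E_G(M + 2) - E_G(M)| ≤ 2 (2/a) K`,
`K = 2(2Δ+1)(2|t| + |U|)`: two addition steps (`groundEnergyAt_succ_le` at `M`, `M + 1`, weights
`2|Λ|/(2|Λ| - M), 2|Λ|/(2|Λ| - M - 1) ≤ 2/a`) and two removal steps (`groundEnergyAt_pred_le` at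
`M + 2`, `M + 1`, weights `2|Λ|/(M + 2), 2|Λ|/(M + 1) ≤ 2/a`). Ruelle (1969) §3.4. [folklore] -/
theorem ptr_abs_groundEnergyAt_add_two_sub_le {Δ : ℕ}
    (hΔ : ∀ x : Λ, (Finset.univ.filter fun y => G.Adj x y).card ≤ Δ) (t U : ℝ) {M : ℕ} {a : ℝ}
    (ha : 0 < a) (h1 : a * (Fintype.card Λ : ℝ) ≤ (M : ℝ) + 1)
    (h2 : (M : ℝ) + 2 ≤ (2 - a) * (Fintype.card Λ : ℝ)) :
    |groundEnergyAt G t U (M + 2) - groundEnergyAt G t U M| ≤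
      2 * (2 / a) * ((2 * Δ + 1 : ℕ) * (2 * (2 * |t| + |U|))) := by
  have hM0 : (0 : ℝ) ≤ M := Nat.cast_nonneg M
  have hC0 : (0 : ℝ) < Fintype.card Λ := by
    rcases (Nat.cast_nonneg (α := ℝ) (Fintype.card Λ)).lt_or_eq with h | h
    · exact h
    · rw [← h] at h2
      linarith
  have haC : 0 < a * (Fintype.card Λ : ℝ) := mul_pos ha hC0
  have hM2r : ((M + 2 : ℕ) : ℝ) < ((2 * Fintype.card Λ : ℕ) : ℝ) := by
    push_cast
    linarith
  have hM2 : M + 2 < 2 * Fintype.card Λ := by exact_mod_cast hM2r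
  -- the four one-particle steps
  have hu1 := ThermodynamicLimit.groundEnergyAt_succ_le G hΔ t U (N := M) (by omega)
  have hu2 := ThermodynamicLimit.groundEnergyAt_succ_le G hΔ t U (N := M + 1) (by omega)
  have hd1 := ThermodynamicLimit.groundEnergyAt_pred_le G hΔ t U (N := M + 1 + 1) (by omega) (by omega)
  have hd2 := ThermodynamicLimit.groundEnergyAt_pred_le G hΔ t U (N := M + 1) (by omega) (by omega)
  rw [Nat.add_sub_cancel] at hd1 hd2
  have e : groundEnergyAt G t U (M + 2) = groundEnergyAt G t U (M + 1 + 1) := rfl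
  rw [e]
  push_cast at hu1 hu2 hd1 hd2 ⊢
  set K : ℝ := (2 * (Δ : ℝ) + 1) * (2 * (2 * |t| + |U|)) with hK
  have hK0 : 0 ≤ K := by positivity
  set C : ℝ := (Fintype.card Λ : ℝ) with hC
  -- the four weights, all `≤ (2/a) K`
  have w1 : K * (2 * C) / (2 * C - M) ≤ 2 / a * K := ptr_weight_le hK0 ha hC0 (by linarith)
  have w2 : K * (2 * C) / (2 * C - (M + 1)) ≤ 2 / a * K := ptr_weight_le hK0 ha hC0 (by linarith)
  have w3 : K * (2 * C) / (M + 1 + 1) ≤ 2 / a * K := ptr_weight_le hK0 ha hC0 (by linarith)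
  have w4 : K * (2 * C) / (M + 1) ≤ 2 / a * K := ptr_weight_le hK0 ha hC0 (by linarith)
  rw [abs_sub_le_iff]
  constructor
  · linarith
  · linarith

/-- **The two-particle cost on the torus in the bulk window.** For `H = hubbardTorus 2 L 1 U`,
`E(k) = minEnergyOn H (szSector k 0)`, and `n` with `aL² ≤ 2n + 1`, `2n + 2 ≤ (2 - a)L²` (`a > 0`):
`|E(2n) - E(2n + 2)| ≤ 2(2/a) · 18(2 + |U|)` (written with the one-particle cost constant at degree `4`,
hopping `1`): the `SU(2)` identification `groundEnergyAt_eq_minEnergyOn_szSector` (`n + 1 ≤ L²`), the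
degree bound `4` of the torus graph, and `ptr_abs_groundEnergyAt_add_two_sub_le`. [folklore] -/
theorem ptr_twoParticleCost (U a : ℝ) (ha : 0 < a) :
    ∃ C₃ : ℝ, 0 ≤ C₃ ∧ ∀ (L : ℕ) [NeZero L] (n : ℕ), a * (L : ℝ) ^ 2 ≤ 2 * (n : ℝ) + 1 →
      2 * (n : ℝ) + 2 ≤ (2 - a) * (L : ℝ) ^ 2 →
      |(hubbardTorus 2 L 1 U).minEnergyOn (szSector (2 * n) 0) -
          (hubbardTorus 2 L 1 U).minEnergyOn (szSector (2 * n + 2) 0)| ≤ C₃ := by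
  refine ⟨2 * (2 / a) * (((2 * 4 + 1 : ℕ) : ℝ) * (2 * (2 * |(1 : ℝ)| + |U|))),
    by positivity, fun L _ n h1 h2 => ?_⟩
  -- the torus graph: `L²` sites, degree `≤ 4`
  have hc : Fintype.card (FermionTorus 2 L) = L ^ 2 := by
    simp [FermionTorus, Fintype.card_lex]
  have hcr : (Fintype.card (FermionTorus 2 L) : ℝ) = (L : ℝ) ^ 2 := by
    rw [hc]
    push_cast
    ring
  have hΔ : ∀ x : FermionTorus 2 L,
      (Finset.univ.filter fun y => (fermionTorusGraph 2 L).Adj x y).card ≤ 4 :=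
    fun x => SourceGas.card_filter_fermionTorusGraph_adj_le x
  have hL0 : (0 : ℝ) < (L : ℝ) ^ 2 := by
    have hL : (L : ℝ) ≠ 0 := by exact_mod_cast NeZero.ne L
    positivity
  have hn1r : ((n + 1 : ℕ) : ℝ) < ((L ^ 2 : ℕ) : ℝ) := by
    push_cast
    nlinarith [mul_pos ha hL0]
  have hn1 : n + 1 < L ^ 2 := by exact_mod_cast hn1r
  -- `SU(2)`: the two sector energies are full ground energies
  have e0 : (hubbardTorus 2 L 1 U).minEnergyOn (szSector (2 * n) 0) =
      groundEnergyAt (fermionTorusGraph 2 L) 1 U (2 * n) :=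
    (groundEnergyAt_eq_minEnergyOn_szSector (fermionTorusGraph 2 L) 1 U (by rw [hc]; omega)).symm
  have ep : (hubbardTorus 2 L 1 U).minEnergyOn (szSector (2 * n + 2) 0) =
      groundEnergyAt (fermionTorusGraph 2 L) 1 U (2 * (n + 1)) := by
    rw [show 2 * n + 2 = 2 * (n + 1) by ring]
    exact (groundEnergyAt_eq_minEnergyOn_szSector (fermionTorusGraph 2 L) 1 U
      (by rw [hc]; omega)).symm
  rw [e0, ep, abs_sub_comm, show 2 * (n + 1) = 2 * n + 2 by ring]
  exact ptr_abs_groundEnergyAt_add_two_sub_le (fermionTorusGraph 2 L) hΔ 1 U ha (M := 2 * n)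
    (by rw [hcr]; push_cast; linarith) (by rw [hcr]; push_cast; linarith)

end TwoParticleCost

/-! ## §3 The real-arithmetic endgames -/

/-- The real bookkeeping of the transfer inequality (3): from the own-bottom identity
`dc = (a₋ - E S₋) + (a₊ - E S₊)`, `dc ≤ C_B L²`, `|E - E₊| ≤ C₃`, `|S₊ - S₋| ≤ C_P L²`, `S₋ ≥ 0`:
`(a₋ - E₋ S₋) + (a₊ - E₊ S₊) ≤ (C_B + C₃ C_P + C_P) L² + max(0, 2E - E₋ - E₊) S₋`, because the left side is
`dc + (2E - E₋ - E₊) S₋ + (E - E₊)(S₊ - S₋)`. [folklore] -/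
theorem ptr_real_transfer {am ap E Em Ep Sm Sp dc CB C₃ CP L2 : ℝ}
    (hre : dc = (am - E * Sm) + (ap - E * Sp)) (hB : dc ≤ CB * L2) (hcost : |E - Ep| ≤ C₃)
    (h6 : |Sp - Sm| ≤ CP * L2) (hSm : 0 ≤ Sm) (hC₃ : 0 ≤ C₃) (hL2 : 0 ≤ CP * L2) :
    am - Em * Sm + (ap - Ep * Sp) ≤ (CB + C₃ * CP + CP) * L2 + max 0 (2 * E - Em - Ep) * Sm := by
  have hx : (E - Ep) * (Sp - Sm) ≤ C₃ * (CP * L2) :=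
    calc (E - Ep) * (Sp - Sm) ≤ |(E - Ep) * (Sp - Sm)| := le_abs_self _
      _ = |E - Ep| * |Sp - Sm| := abs_mul _ _
      _ ≤ C₃ * (CP * L2) := mul_le_mul hcost h6 (abs_nonneg _) hC₃
  have hy : (2 * E - Em - Ep) * Sm ≤ max 0 (2 * E - Em - Ep) * Sm :=
    mul_le_mul_of_nonneg_right (le_max_right _ _) hSm
  rw [hre] at hB
  linarith

/-- The real bookkeeping of the inheritance inequality (4): if `T = a₁`, `d = a₁ - a₂`, `S² ≤ a₂`,
`|d| ≤ B S`, `B ≤ C` and `S ≥ 0`, then `S² - C S ≤ T`. [folklore] -/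
theorem ptr_real_inherit {T a₁ a₂ d S B C : ℝ} (hT : T = a₁) (hd : d = a₁ - a₂) (ha₂ : S ^ 2 ≤ a₂)
    (hdB : |d| ≤ B * S) (hBC : B ≤ C) (hS : 0 ≤ S) : S ^ 2 - C * S ≤ T := by
  have h1 := (abs_le.1 hdB).1
  have h2 : B * S ≤ C * S := mul_le_mul_of_nonneg_right hBC hS
  linarith

/-! ## §4 The registered stub -/

/-- **`stub_pairTransferRung`** (the RUNG of the line `floating-mu-two-sided-pair-transfer`, crux
`SsbToEvenTorusLro`). For every real `U` and `a > 0` there is `C = C(U, a)` such that for every side `L`,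
every `m` in the bulk window `aL² ≤ m`, `m + 4 ≤ (2 - a)L²`, and every normalised ground state `ψ` of
`H = hubbardTorus 2 L 1 U` in the sector `(m + 2, S^z = 0)`, with `P = pairField dWaveFormFactor L`,
`E_k = minEnergyOn H (szSector k 0)`, `S₋ = Re⟨ψ,PᴴPψ⟩`, `S₊ = Re⟨ψ,PPᴴψ⟩`:
(1) `Pψ ∈ szSector m 0`; (2) `Pᴴψ ∈ szSector (m+4) 0`; (3) the two-sided Koma–Tasaki transfer inequality
`(Re⟨Pψ,HPψ⟩ - E_m S₋) + (Re⟨Pᴴψ,HPᴴψ⟩ - E_{m+4} S₊) ≤ CL² + max(0, 2E_{m+2} - E_m - E_{m+4}) S₋`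
(own-bottom identity `mc_dotProduct_doubleComm_of_eigen` + double-commutator budget + two-particle cost ×
single-commutator budget); (4) `S₋² - CL² S₋ ≤ Re⟨Pψ, PᴴP Pψ⟩` and (5) `S₊² ≤ Re⟨Pᴴψ, PᴴP Pᴴψ⟩`
(Cauchy–Schwarz, `‖ψ‖ = 1`, and the single-commutator budget); (6) `|S₊ - S₋| ≤ CL²`. The sector
`(m + 2, 0)` is nonempty only for even `m` (`not_isGroundStateInSector_zero_odd`). Koma–Tasaki 1994,
eq. (2.9) and the proof of Theorem 2.2. [cite: KomaTasaki1994, Theorem 2.2] -/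
theorem stub_pairTransferRung :
    ∀ (U a : ℝ), 0 < a → ∃ C : ℝ, ∀ (L : ℕ) [NeZero L] (m : ℕ) (ψ : Fock (Orb (FermionTorus 2 L))), a * (L : ℝ) ^ 2 ≤ (m : ℝ) → (m : ℝ) + 4 ≤ (2 - a) * (L : ℝ) ^ 2 → IsGroundStateInSector (hubbardTorus 2 L 1 U) (m + 2) 0 ψ → star ψ ⬝ᵥ ψ = 1 → pairField dWaveFormFactor L *ᵥ ψ ∈ szSector m 0 ∧ (pairField dWaveFormFactor L)ᴴ *ᵥ ψ ∈ szSector (m + 4) 0 ∧ (expect (hubbardTorus 2 L 1 U) (pairField dWaveFormFactor L *ᵥ ψ)).re - (hubbardTorus 2 L 1 U).minEnergyOn (szSector m 0) * (expect ((pairField dWaveFormFactor L)ᴴ * pairField dWaveFormFactor L) ψ).re + ((expect (hubbardTorus 2 L 1 U) ((pairField dWaveFormFactor L)ᴴ *ᵥ ψ)).re - (hubbardTorus 2 L 1 U).minEnergyOn (szSector (m + 4) 0) * (expect (pairField dWaveFormFactor L * (pairField dWaveFormFactor L)ᴴ) ψ).re) ≤ C * (L : ℝ) ^ 2 + max 0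 (2 * (hubbardTorus 2 L 1 U).minEnergyOn (szSector (m + 2) 0) - (hubbardTorus 2 L 1 U).minEnergyOn (szSector m 0) - (hubbardTorus 2 L 1 U).minEnergyOn (szSector (m + 4) 0)) * (expect ((pairField dWaveFormFactor L)ᴴ * pairField dWaveFormFactor L) ψ).re ∧ (expect ((pairField dWaveFormFactor L)ᴴ * pairField dWaveFormFactor L) ψ).re ^ 2 - C * (L : ℝ) ^ 2 * (expect ((pairField dWaveFormFactor L)ᴴ * pairField dWaveFormFactor L) ψ).re ≤ (expect ((pairField dWaveFormFactor L)ᴴ * pairField dWaveFormFactor L) (pairField dWaveFormFactor L *ᵥ ψ)).re ∧ (expect (pairField dWaveFormFactor L * (pairField dWaveFormFactor L)ᴴ) ψ).re ^ 2 ≤ (expect ((pairField dWaveFormFactor L)ᴴ * pairField dWaveFormFactor L) ((pairField dWaveFormFactor L)ᴴ *ᵥ ψ)).re ∧ |(expect (pairField dWaveFormFactor L * (pairField dWaveFormFactor L)ᴴ) ψ).re - (expect ((pairField dWaveFormFactor L)ᴴ * pairField dWaveFormFactor L) ψ).re| ≤ C * (L : ℝ) ^ 2 := by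
  intro U a ha
  obtain ⟨CP, hCP0, hCP⟩ := ptr_pairCommutator_budget
  obtain ⟨CB, hCB0, hCB⟩ := ptr_doubleComm_budget U
  obtain ⟨C₃, hC₃0, hC₃⟩ := ptr_twoParticleCost U a ha
  refine ⟨CB + C₃ * CP + CP, fun L _ m ψ hm1 hm2 hgs hψ1 => ?_⟩
  -- parity: the sector `(m + 2, S^z = 0)` is empty unless `m + 2` is even
  have hev : Even (m + 2) := by
    by_contra hodd
    exact SsbToEvenTorusLro.Negative.not_isGroundStateInSector_zero_odd
      (Nat.not_even_iff_odd.1 hodd) _ _ hgs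
  obtain ⟨n, hn⟩ := hev
  obtain ⟨hψK, -, hHψ⟩ := hgs
  -- (1), (2): sector bookkeeping at momentum zero
  have h1 : pairField dWaveFormFactor L *ᵥ ψ ∈ szSector m 0 := by
    have h := WcbcsSsbToTorusLRO.pairFieldAt_mulVec_mem_szSector dWaveFormFactor
      (0 : TorusSite 2 L) (N := m + 2) (by omega) hψK
    rwa [pairFieldAt_zero, Nat.add_sub_cancel] at h
  have h2 : (pairField dWaveFormFactor L)ᴴ *ᵥ ψ ∈ szSector (m + 4) 0 := by
    have h := WcbcsSsbToTorusLRO.conjTranspose_pairFieldAt_mulVec_mem_szSector dWaveFormFactor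
      (0 : TorusSite 2 L) hψK
    rwa [pairFieldAt_zero] at h
  -- the two-particle cost `|E_{m+2} - E_{m+4}| ≤ C₃`
  have hcost : |(hubbardTorus 2 L 1 U).minEnergyOn (szSector (m + 2) 0) -
      (hubbardTorus 2 L 1 U).minEnergyOn (szSector (m + 4) 0)| ≤ C₃ := by
    have hm2 : m + 2 = 2 * n := by omega
    have hm4 : m + 4 = 2 * n + 2 := by omega
    have hnr : (m : ℝ) + 2 = 2 * (n : ℝ) := by exact_mod_cast hm2
    rw [hm2, hm4]
    exact hC₃ L n (by linarith) (by linarith)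
  -- unfold the expectations and abbreviate
  simp only [expect]
  set H := hubbardTorus 2 L 1 U with hH
  set P := pairField dWaveFormFactor L with hP
  have hHerm : H.IsHermitian := LiebThm1.hamiltonian_isHermitian (fermionTorusGraph 2 L) 1 U
  have hψre : (star ψ ⬝ᵥ ψ).re = 1 := by rw [hψ1, Complex.one_re]
  -- Gram identities `‖Pψ‖² = ⟨ψ,PᴴPψ⟩`, `‖Pᴴψ‖² = ⟨ψ,PPᴴψ⟩` (also at `φ = Pψ`)
  have hSm : star (P *ᵥ ψ) ⬝ᵥ (P *ᵥ ψ) = star ψ ⬝ᵥ ((Pᴴ * P) *ᵥ ψ) :=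
    Literature.MathematicalPhysics.QuantumLattice.star_mulVec_dotProduct_mulVec P P ψ
  have hSp : star (Pᴴ *ᵥ ψ) ⬝ᵥ (Pᴴ *ᵥ ψ) = star ψ ⬝ᵥ ((P * Pᴴ) *ᵥ ψ) := by
    rw [Literature.MathematicalPhysics.QuantumLattice.star_mulVec_dotProduct_mulVec,
      conjTranspose_conjTranspose]
  have hSm0 : 0 ≤ (star ψ ⬝ᵥ ((Pᴴ * P) *ᵥ ψ)).re := by
    rw [← hSm]; exact (Complex.nonneg_iff.1 (dotProduct_star_self_nonneg _)).1
  have hSp0 : 0 ≤ (star ψ ⬝ᵥ ((P * Pᴴ) *ᵥ ψ)).re := by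
    rw [← hSp]; exact (Complex.nonneg_iff.1 (dotProduct_star_self_nonneg _)).1
  -- the single-commutator budget at `ψ`: conjunct (6)
  have h6 : |(star ψ ⬝ᵥ ((P * Pᴴ) *ᵥ ψ)).re - (star ψ ⬝ᵥ ((Pᴴ * P) *ᵥ ψ)).re| ≤ CP * (L : ℝ) ^ 2 := by
    have h := hCP L ψ
    rw [sub_mulVec, dotProduct_sub, Complex.sub_re, hψre, mul_one, abs_sub_comm] at h
    exact h
  have hL2 : 0 ≤ CP * (L : ℝ) ^ 2 := by positivity
  have hCle : CP * (L : ℝ) ^ 2 ≤ (CB + C₃ * CP + CP) * (L : ℝ) ^ 2 := by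
    have : 0 ≤ (CB + C₃ * CP) * (L : ℝ) ^ 2 := by positivity
    linarith
  refine ⟨h1, h2, ?_, ?_, ?_, h6.trans hCle⟩
  · -- (3): the own-bottom identity and the three budgets
    have hDC := WcbcsSsbToTorusLRO.mc_dotProduct_doubleComm_of_eigen hHerm hHψ P
    have hre := congrArg Complex.re hDC
    rw [Complex.add_re, Complex.sub_re, Complex.sub_re, Complex.re_ofReal_mul,
      Complex.re_ofReal_mul, hSm, hSp] at hre
    have hB := hCB L ψ
    rw [hψre, mul_one] at hB
    exact ptr_real_transfer hre ((le_abs_self _).trans hB) hcost h6 hSm0 hC₃0 hL2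
  · -- (4): `‖PPψ‖² = ‖PᴴPψ‖² + Re⟨Pψ,(PᴴP - PPᴴ)Pψ⟩ ≥ S₋² - C_P L² S₋`
    have hT : star (P *ᵥ ψ) ⬝ᵥ ((Pᴴ * P) *ᵥ (P *ᵥ ψ)) =
        star (P *ᵥ (P *ᵥ ψ)) ⬝ᵥ (P *ᵥ (P *ᵥ ψ)) :=
      (Literature.MathematicalPhysics.QuantumLattice.star_mulVec_dotProduct_mulVec P P (P *ᵥ ψ)).symm
    have hSpφ : star (Pᴴ *ᵥ (P *ᵥ ψ)) ⬝ᵥ (Pᴴ *ᵥ (P *ᵥ ψ)) =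
        star (P *ᵥ ψ) ⬝ᵥ ((P * Pᴴ) *ᵥ (P *ᵥ ψ)) := by
      rw [Literature.MathematicalPhysics.QuantumLattice.star_mulVec_dotProduct_mulVec,
        conjTranspose_conjTranspose]
    have hdiff : (star (P *ᵥ ψ) ⬝ᵥ ((Pᴴ * P - P * Pᴴ) *ᵥ (P *ᵥ ψ))).re =
        (star (P *ᵥ (P *ᵥ ψ)) ⬝ᵥ (P *ᵥ (P *ᵥ ψ))).re -
          (star (Pᴴ *ᵥ (P *ᵥ ψ)) ⬝ᵥ (Pᴴ *ᵥ (P *ᵥ ψ))).re := by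
      rw [sub_mulVec, dotProduct_sub, Complex.sub_re, ← hT, hSpφ]
    -- Cauchy–Schwarz: `S₋² ≤ ‖PᴴPψ‖²`
    have hv : Pᴴ *ᵥ (P *ᵥ ψ) = (Pᴴ * P) *ᵥ ψ := mulVec_mulVec _ _ _
    have hcs : (star ψ ⬝ᵥ ((Pᴴ * P) *ᵥ ψ)).re ^ 2 ≤
        (star (Pᴴ *ᵥ (P *ᵥ ψ)) ⬝ᵥ (Pᴴ *ᵥ (P *ᵥ ψ))).re := by
      rw [hv, ← eucNorm_sq]
      have hle : (star ψ ⬝ᵥ ((Pᴴ * P) *ᵥ ψ)).re ≤ eucNorm ((Pᴴ * P) *ᵥ ψ) :=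
        (Complex.re_le_norm _).trans (norm_star_dotProduct_le_eucNorm hψ1 _)
      exact pow_le_pow_left₀ hSm0 hle 2
    -- the single-commutator budget at `φ = Pψ`
    have hB := hCP L (P *ᵥ ψ)
    rw [hSm] at hB
    exact ptr_real_inherit (congrArg Complex.re hT) hdiff hcs hB hCle hSm0
  · -- (5): `‖PPᴴψ‖² ≥ S₊²` (Cauchy–Schwarz)
    have hT : star (Pᴴ *ᵥ ψ) ⬝ᵥ ((Pᴴ * P) *ᵥ (Pᴴ *ᵥ ψ)) =
        star (P *ᵥ (Pᴴ *ᵥ ψ)) ⬝ᵥ (P *ᵥ (Pᴴ *ᵥ ψ)) :=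
      (Literature.MathematicalPhysics.QuantumLattice.star_mulVec_dotProduct_mulVec P P (Pᴴ *ᵥ ψ)).symm
    have hw : P *ᵥ (Pᴴ *ᵥ ψ) = (P * Pᴴ) *ᵥ ψ := mulVec_mulVec _ _ _
    rw [hT, hw, ← eucNorm_sq]
    have hle : (star ψ ⬝ᵥ ((P * Pᴴ) *ᵥ ψ)).re ≤ eucNorm ((P * Pᴴ) *ᵥ ψ) :=
      (Complex.re_le_norm _).trans (norm_star_dotProduct_le_eucNorm hψ1 _)
    exact pow_le_pow_left₀ hSp0 hle 2

end Summit.HubbardSuperconductivity.HubbardSuperconductivity.Theorems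

end
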